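import Mathlib
import Summits.MatrixMultiplication.MatrixMultiplication.Theses.ShapeSubmodularity
import Summits.MatrixMultiplication.MatrixMultiplication.Theses.CubicExchangeSplit
import Summits.MatrixMultiplication.MatrixMultiplication.Theorems.ShapeSubmodularityShapeSubmodularSummitEquivalence

/-!
# Crux `ShapeSubmodular` (stmt-MatrixMultiplication-15622) ⟸ `CubicAmortisation ∧ CubicExchange` — the redirect split, by name

Strategist output (b) for the summit-equivalent crux `ShapeSubmodularity.ShapeSubmodular` (SUBMOD;
`ShapeSubmodular_iff_MatrixMultiplication`, p163744, since its sibling E = `PerfectAmortisation` is the KNOWN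
theorem of Coppersmith 1982 / Lotti–Romani 1983 Prop. 4.1, proved in tree 2026-08-17).  The typed split of SUBMOD
into two pieces neither of which is known to give the summit on its own is the k = 3 cell of the route's own bridge,
filed at route level as `route-MatrixMultiplication-CubicExchangeSplit` (cruxes `CubicAmortisation` = E₃,
stmt-18000, and `CubicExchange` = SUBMOD₃, stmt-18001; deciding theorem `CubicExchangeSplit.closes` proved in that
route file).  This file records the split AT THE LEVEL OF THE CRUX, kernel-checked:

* `ShapeSubmodular_of_subs : CubicAmortisation → CubicExchange → ShapeSubmodular` — the assembly `X_of_subs`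
  (`CubicExchangeSplit.closes`, then the landed necessity direction `ω(ℂ) = 2 → SUBMOD` inside the iff);
* `shapeSubmodularOfSubs_proof : CubicExchangeSplit.ShapeSubmodularOfSubs` — route item stmt-MatrixMultiplication-18007
  BY NAME (its statement inlines the three signatures verbatim; the proof is the same term up to `δ`-unfolding).

No new definitions; axioms `propext`, `Classical.choice`, `Quot.sound` only.  The parent route ShapeSubmodularity is
CLOSED `superseded:route-MatrixMultiplication-CubicExchangeSplit` (2026-08-17T14:08Z); this theorem is the formal edge
between the moot crux and its successor's cruxes.  See `Cruxes/ShapeSubmodular/STRATEGY-CENSUS.md` for why no other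
split of SUBMOD short of the summit has teeth (and for the pencil-model remark on `CubicExchange`).
-/

set_option linter.dupNamespace false
-- (single-conjunct summit: the namespace repeats `MatrixMultiplication`)

namespace Summit.MatrixMultiplication.MatrixMultiplication.Theorems.ShapeSubmodular

open Summit.MatrixMultiplication.MatrixMultiplication.Theses

/-- **The redirect split of the crux**: perfect cubic amortisation `E₃` and the cubic exchange `SUBMOD₃` together
give SUBMOD on the whole integer format lattice (through `ω(ℂ) = 2`: `CubicExchangeSplit.closes`, then
`ShapeSubmodular_iff_MatrixMultiplication.2`). [folklore] -/
theorem ShapeSubmodular_of_subs : Summit.MatrixMultiplication.MatrixMultiplication.Theses.CubicExchangeSplit.CubicAmortisation → Summit.MatrixMultiplication.MatrixMultiplication.Theses.CubicExchangeSplit.CubicExchange → Summit.MatrixMultiplication.MatrixMultiplication.Theses.ShapeSubmodularity.ShapeSubmodular :=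
  fun hA hX => ShapeSubmodular_iff_MatrixMultiplication.2 (CubicExchangeSplit.closes hA hX)

/-- Route item `CubicExchangeSplit.ShapeSubmodularOfSubs` (stmt-MatrixMultiplication-18007) BY NAME:
`E₃ → SUBMOD₃ → SUBMOD`, all three signatures inlined in the item. [folklore] -/
theorem shapeSubmodularOfSubs_proof : CubicExchangeSplit.ShapeSubmodularOfSubs :=
  fun hA hX => ShapeSubmodular_of_subs hA hX

end Summit.MatrixMultiplication.MatrixMultiplication.Theorems.ShapeSubmodular
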